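import Literature.AlgebraicGeometry.ModuliOfAbelianVarieties.SiegelFineModuliPoints
import Literature.AlgebraicGeometry.AbelianSchemes.PolarizedAbelianSchemeWithLevelBaseChange
import HarnessLib

/-!
# FINE-MODULI POINTS, BASE-FREE: isomorphic pulled-back triples ⇒ EQUAL classifying points for ANY fine-moduli datum
# (sequel of ★ `SiegelFineModuliPoints`, A-p04 (g23) p847417)

Topic `AlgebraicGeometry/ModuliOfAbelianVarieties`; namespace `Literature.AlgebraicGeometry.ModuliOfAbelianVarieties`.  THEOREMS ONLY (no
definition, no named fact, no instance, no notation, no `sorry`).  Cell hodgecm-mathlib (D-0151), P6 «MOD programme» (crux hLiu418 =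
stmt-HodgeConjecture-24832, `--supports`, count-neutral): the organ «FINE-MODULI POINTS» of LEAD F0P6-plan (g3) ruling «M-47» (2026-09-02
00:23Z; A-p13 (g37)) — the law `stub_INJ0`∕`stub_INJ` of the P-line `Lines/F0_P6a_PELInputs.lean` becomes payable once the spread carries a
CLASSIFYING-MAP provenance `j : 𝓨 → 𝓜` injective on geometric points, by «isomorphic tuples at two points ⇒ the two classifying points
coincide».  HC_CM is proved only modulo the printed citations until rung 0 closes; this file is generic and changes no count.

THE MATHEMATICS ([MumfordFogartyKirwan1994] Ch. 7 §2 Def. 7.2–7.3, §3 Thm. 7.9): a fine moduli scheme `M` with universal triple `univ`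
REPRESENTS the functor `T ↦ {triples over T}∕≅`; hence two morphisms `x₁, x₂ : T → M` whose pulled-back triples `x₁^* univ`, `x₂^* univ`
are ISOMORPHIC AS TRIPLES (the relation ★ `PolarizedAbelianSchemeWithLevel.IsBaseChangeVia` along `𝟙 T`) are EQUAL: `x₁^* univ` is then a
pull-back of `univ` along `𝟙 ≫ x₂ = x₂` as well as along `x₁` (★ `baseChange_isBaseChangeVia`, transitivity ★ `IsBaseChangeVia.trans`), and
the classifying map is unique (★ `SiegelFineModuliScheme.classify`).  The tree already has the converse «equal classifying maps ⇒ isomorphic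
triples» (★ `exists_isBaseChangeVia_id_of_classifyingMap_eq`); §1 is base-free (any `univ` over any `M`, no moduli property), so any other
fine-moduli object (an integral model of `A_{g,δ,N}`, E-line ED. 4's `𝓜ch`) gets the points lemma from its own uniqueness clause in one line.

The `ℚ`-Siegel case (★ `SiegelFineModuliScheme.eq_of_isBaseChangeVia_id`, `…eq_iff_exists_isBaseChangeVia_id`, `algPoints_eq_of_isBaseChangeVia_id`)
is ★ p847417 (A-p04 (g23), filed 13 s before this hand's TAKING line); THIS FILE adds the two shapes M-47 still needs:
* §1 BASE-FREE (any `univ : PolarizedAbelianSchemeWithLevel g N δ M` over ANY scheme `M`, no moduli property; the hook for an INTEGRAL ∕ other-base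
  fine-moduli object such as E-line ED. 4's `𝓜ch`, whose special fibre is where `stub_INJ0` lives): `isBaseChangeVia_of_isBaseChangeVia_id_baseChange` —
  iso of `x₁^* univ` with `x₂^* univ` along `𝟙 T` ⇒ `x₁^* univ` is a pull-back of `univ` along `x₂`; `eq_of_isBaseChangeVia_id_of_unique` — hence
  `x₁ = x₂` for any `univ` whose pull-back relation has UNIQUE classifying maps (the uniqueness half of «fine» as a hypothesis).
* §2 `SiegelFineModuliScheme.eq_of_tupleRel_id` — the UNPACKAGED form over `(univ.A, univ.D, univ.pol, univ.level).baseChange xᵢ` (the four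
  Def-7.2 conjuncts = the P6a `tupleIsoAt` body minus its `𝒪`-action clause; ★ `baseChange_A∕_D∕_pol∕_level` are `rfl`), over ★ p847417.

## References
* [MumfordFogartyKirwan1994] D. Mumford, J. Fogarty, F. Kirwan, *Geometric Invariant Theory*, 3rd ed. (1994), Ch. 7 §2 Definition 7.2–7.3
  (p. 129), §3 Theorem 7.9 (p. 139).
* [Deligne1971TravauxShimura] P. Deligne, *Travaux de Shimura*, Sém. Bourbaki 389 (1971), 4.16 (p. 150).
-/

set_option autoImplicit false

noncomputable section

universe u

open CategoryTheory CategoryTheory.Limits AlgebraicGeometry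
open Literature.AlgebraicGeometry.AbelianSchemes

namespace Literature.AlgebraicGeometry.ModuliOfAbelianVarieties

/-! ### §1 Base-free: an isomorphism of pulled-back triples along `𝟙 T` re-bases the classifying relation -/

section BaseFree

variable {g N : ℕ} {δ : Fin g → ℕ} {M T : Scheme.{u}} (univ : PolarizedAbelianSchemeWithLevel g N δ M) (x₁ x₂ : T ⟶ M)

/-- **If `x₁^* univ ≅ x₂^* univ` as triples (along `𝟙 T`), then `x₁^* univ` is a pull-back of `univ` along `x₂`** (compose the isomorphism of
triples with the base-change relation of `x₂^* univ`, ★ `PolarizedAbelianSchemeWithLevel.baseChange_isBaseChangeVia`, by ★ `IsBaseChangeVia.trans`;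
`𝟙 ≫ x₂ = x₂`). [cite: MumfordFogartyKirwan1994, Ch. 7 §2 Definition 7.2 (p. 129) and Definition 7.3 (p. 129)] -/
theorem isBaseChangeVia_of_isBaseChangeVia_id_baseChange
    {G : (univ.baseChange x₁).A.X.left ⟶ (univ.baseChange x₂).A.X.left}
    {Ĝ : (univ.baseChange x₁).D.hat.X.left ⟶ (univ.baseChange x₂).D.hat.X.left}
    (h : (univ.baseChange x₁).IsBaseChangeVia (univ.baseChange x₂) (𝟙 T) G Ĝ) :
    ∃ (G' : (univ.baseChange x₁).A.X.left ⟶ univ.A.X.left) (Ĝ' : (univ.baseChange x₁).D.hat.X.left ⟶ univ.D.hat.X.left),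
      (univ.baseChange x₁).IsBaseChangeVia univ x₂ G' Ĝ' := by
  have h₂ := h.trans (univ.baseChange_isBaseChangeVia x₂)
  rw [Category.id_comp] at h₂
  exact ⟨_, _, h₂⟩

/-- **Hence `x₁ = x₂` whenever the classifying maps of `univ` are UNIQUE** (the uniqueness half of «fine», as a hypothesis: any two morphisms
along which the same triple is a pull-back of `univ` coincide) — `x₁^* univ` is a pull-back along `x₁` (★ `baseChange_isBaseChangeVia`) and along
`x₂` (previous lemma). [cite: MumfordFogartyKirwan1994, Ch. 7 §3 Theorem 7.9 (p. 139)] -/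
theorem eq_of_isBaseChangeVia_id_of_unique
    (huniq : ∀ (P' : PolarizedAbelianSchemeWithLevel g N δ T) (f₁ f₂ : T ⟶ M)
      {G₁ : P'.A.X.left ⟶ univ.A.X.left} {Ĝ₁ : P'.D.hat.X.left ⟶ univ.D.hat.X.left}
      {G₂ : P'.A.X.left ⟶ univ.A.X.left} {Ĝ₂ : P'.D.hat.X.left ⟶ univ.D.hat.X.left},
      P'.IsBaseChangeVia univ f₁ G₁ Ĝ₁ → P'.IsBaseChangeVia univ f₂ G₂ Ĝ₂ → f₁ = f₂)
    {G : (univ.baseChange x₁).A.X.left ⟶ (univ.baseChange x₂).A.X.left}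
    {Ĝ : (univ.baseChange x₁).D.hat.X.left ⟶ (univ.baseChange x₂).D.hat.X.left}
    (h : (univ.baseChange x₁).IsBaseChangeVia (univ.baseChange x₂) (𝟙 T) G Ĝ) : x₁ = x₂ := by
  obtain ⟨G', Ĝ', h₂⟩ := isBaseChangeVia_of_isBaseChangeVia_id_baseChange univ x₁ x₂ h
  exact huniq _ x₁ x₂ (univ.baseChange_isBaseChangeVia x₁) h₂

end BaseFree

/-! ### §2 The Siegel fine moduli scheme over `ℚ`: the unpackaged form (over ★ `SiegelFineModuliPoints`) -/

namespace SiegelFineModuliScheme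

variable {g N : ℕ} {δ : Fin g → ℕ} (𝓜 : SiegelFineModuliScheme g N δ) {T : Motives.SchemeOver ℚ} [IsLocallyNoetherian T.left]

/-- **FINE-MODULI POINTS, UNPACKAGED**: the same with the isomorphism of triples given by its four conjuncts over `univ.A.baseChange xᵢ`,
`univ.D.baseChange xᵢ`, `univ.pol.baseChange xᵢ`, `univ.level.baseChange xᵢ` (the components of ★ `PolarizedAbelianSchemeWithLevel.baseChange`
are these by `rfl`) — the shape in which a P6a `tupleIsoAt x₁ x₂ univ.A ρ univ.D univ.pol univ.level` hypothesis arrives after dropping its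
`𝒪`-action clause. [cite: MumfordFogartyKirwan1994, Ch. 7 §2 Definition 7.2 (p. 129) and §3 Theorem 7.9 (p. 139)] -/
theorem eq_of_tupleRel_id (x₁ x₂ : T ⟶ 𝓜.M)
    {G : (𝓜.univ.A.baseChange x₁.left).X.left ⟶ (𝓜.univ.A.baseChange x₂.left).X.left}
    {Ĝ : (𝓜.univ.D.baseChange x₁.left).hat.X.left ⟶ (𝓜.univ.D.baseChange x₂.left).hat.X.left}
    (h : (𝓜.univ.level.baseChange x₁.left).IsBaseChangeVia (𝓜.univ.level.baseChange x₂.left) (𝟙 T.left) G ∧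
      (𝓜.univ.D.baseChange x₁.left).hat.IsBaseChangeVia (𝓜.univ.D.baseChange x₂.left).hat (𝟙 T.left) Ĝ ∧
      (∃ (wG : (𝓜.univ.A.baseChange x₁.left).X.hom ≫ 𝟙 T.left = G ≫ (𝓜.univ.A.baseChange x₂.left).X.hom)
          (wĜ : (𝓜.univ.D.baseChange x₁.left).hat.X.hom ≫ 𝟙 T.left = Ĝ ≫ (𝓜.univ.D.baseChange x₂.left).hat.X.hom),
        Nonempty ((Scheme.Modules.pullback
          (pullback.map (𝓜.univ.A.baseChange x₁.left).X.hom (𝓜.univ.D.baseChange x₁.left).hat.X.hom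
            (𝓜.univ.A.baseChange x₂.left).X.hom (𝓜.univ.D.baseChange x₂.left).hat.X.hom G Ĝ (𝟙 T.left) wG wĜ)).obj
            (𝓜.univ.D.baseChange x₂.left).P ≅ (𝓜.univ.D.baseChange x₁.left).P)) ∧
      (𝓜.univ.pol.baseChange x₁.left).lam.left ≫ Ĝ = G ≫ (𝓜.univ.pol.baseChange x₂.left).lam.left) : x₁ = x₂ :=
  𝓜.eq_of_isBaseChangeVia_id T x₁ x₂ h

end SiegelFineModuliScheme

end Literature.AlgebraicGeometry.ModuliOfAbelianVarieties

end
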